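import Summits.AtomisticToContinuum.BoseEinsteinCondensation.Theses.BECRieszReverseHolder
import Literature.MathematicalPhysics.QuantumManyBody.BosonicFloorSymmetrisation
import Literature.MathematicalPhysics.QuantumManyBody.GroundStateDirichletForm

/-!
# Route `BECRieszReverseHolder` — support item `PositiveNearMinimiserExists` (stmt-AtomisticToContinuum-12845)

Closes stmt-AtomisticToContinuum-12845 (exact signature of
`Summit.AtomisticToContinuum.BoseEinsteinCondensation.Theses.BECRieszReverseHolder.PositiveNearMinimiserExists`):
for every radial profile `v : ℝ → ℝ≥0∞` (no measurability or admissibility needed), every `N`, `L`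
with `E₀ = groundStateEnergy v N L ≠ ⊤` and every `δ > 0` there is a Dirichlet trial state
`Φ ∈ TrialState N L` with `energy v Φ ≤ E₀ + δ` and `Φ = ‖Φ‖` pointwise (`Φ ≥ 0`).

Proof (the planner's mollifier-free construction; Lieb–Loss, *Analysis*, Thm. 6.17/7.8 for the
gradient of a regularised modulus). Take `δ' = min δ 1` and a trial state `Ψ` with
`energy v Ψ < E₀ + δ'/2` (definition of the infimum; `E₀ ≠ ⊤`). For `ε > 0` the regularised
modulus `G_ε = √(ε² + |Ψ|²) − ε` is `C¹`, Bose-symmetric, vanishes wherever `Ψ` does (so the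
Dirichlet condition is inherited), is real and non-negative, and satisfies POINTWISE
`|∇G_ε|² ≤ |∇Ψ|²` (convexity inequality for gradients,
`BosonicFloorSymmetrisation.nnnorm_fderiv_ofReal_sqrtReg_sq_le` with a one-element family) and
`G_ε² ≤ |Ψ|²`; hence the normalised state `Φ_ε = G_ε / ‖G_ε‖₂` has
`energy v Φ_ε ≤ ‖G_ε‖₂⁻² · energy v Ψ` (only monotonicity of `∫⁻` and pulling out a finite
constant are used, so `v` may be arbitrary, `⊤`-valued included). Finally `‖G_{1/(n+1)}‖₂² → 1`
by dominated convergence (`G_ε² ≤ |Ψ|²`, `∫|Ψ|² = 1`, `G_ε → |Ψ|` pointwise), so for `n` large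
`‖G_ε‖₂² ≠ 0` and `‖G_ε‖₂⁻² · energy v Ψ ≤ energy v Ψ + δ'/2 ≤ E₀ + δ' ≤ E₀ + δ`.

The construction is packaged once abstractly (`exists_trialState_of_dominated`: any `C¹`,
symmetric, real non-negative `G` dominated by `Ψ` in kinetic density and modulus, with
`∫|G|² ≠ 0`, normalises to a non-negative trial state of energy `≤ (∫|G|²)⁻¹ · energy v Ψ`).
-/

noncomputable section

namespace Summit.AtomisticToContinuum.BoseEinsteinCondensation.Theorems

open MeasureTheory Filter Topology
open scoped ENNReal NNReal
open Literature.MathematicalPhysics.QuantumManyBody.BoseGas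

namespace PositiveNearMinimiserExists

variable {N : ℕ} {L : ℝ}

/-! ### Normalising a dominated non-negative comparison function -/

/-- **Abstract normalisation step.** Let `Ψ ∈ TrialState N L` and let `G : (ℝ³)^N → ℂ` be `C¹`,
vanish wherever `Ψ` does, be Bose-symmetric and real non-negative (`G = ‖G‖`), and be dominated by
`Ψ` pointwise: `|∇G|² ≤ |∇Ψ|²` (kinetic densities) and `|G|² ≤ |Ψ|²`. If `A = ∫|G|² ≠ 0` then
`Φ = A^{-1/2} G` is a non-negative trial state with `energy v Φ ≤ A⁻¹ · energy v Ψ`, for every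
profile `v` (monotonicity of the lower Lebesgue integral only). [folklore] -/
theorem exists_trialState_of_dominated (v : ℝ → ℝ≥0∞) (Ψ : TrialState N L) {G : Config N → ℂ}
    (hG : ContDiff ℝ 1 G) (hG0 : ∀ X, Ψ.ψ X = 0 → G X = 0)
    (hGsymm : ∀ (σ : Equiv.Perm (Fin N)) (X : Config N), G (X ∘ σ) = G X)
    (hGreal : ∀ X, G X = (‖G X‖ : ℂ))
    (hkin : ∀ X, kineticDensity G X ≤ kineticDensity Ψ.ψ X)
    (hsq : ∀ X, ((‖G X‖₊ : ℝ≥0∞)) ^ 2 ≤ ((‖Ψ.ψ X‖₊ : ℝ≥0∞)) ^ 2)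
    (hA0 : ∫⁻ X, ((‖G X‖₊ : ℝ≥0∞)) ^ 2 ≠ 0) :
    ∃ Φ : TrialState N L,
      energy v Φ ≤ (∫⁻ X, ((‖G X‖₊ : ℝ≥0∞)) ^ 2)⁻¹ * energy v Ψ ∧ ∀ X, Φ.ψ X = (‖Φ.ψ X‖ : ℂ) := by
  set A : ℝ≥0∞ := ∫⁻ X, ((‖G X‖₊ : ℝ≥0∞)) ^ 2 with hA
  have hA1 : A ≤ 1 := by
    rw [← Ψ.norm_eq]
    exact lintegral_mono hsq
  have hAtop : A ≠ ⊤ := ne_top_of_le_ne_top ENNReal.one_ne_top hA1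
  have hmeas : Measurable (fun X => ((‖G X‖₊ : ℝ≥0∞)) ^ 2) :=
    (hG.continuous.measurable.nnnorm.coe_nnreal_ennreal).pow_const 2
  -- the normalisation constant `k = A^{-1/2}`
  let k : ℝ≥0 := NNReal.sqrt (A.toNNReal)⁻¹
  have hk2 : ((k : ℝ≥0∞)) ^ 2 = A⁻¹ := by
    rw [← ENNReal.coe_pow, NNReal.sq_sqrt,
      ENNReal.coe_inv (ENNReal.toNNReal_ne_zero.2 ⟨hA0, hAtop⟩), ENNReal.coe_toNNReal hAtop]
  have hk : ((k : ℝ≥0∞)) ^ 2 * A = 1 := by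
    rw [hk2, ENNReal.inv_mul_cancel hA0 hAtop]
  have hknorm : ((‖(k : ℂ)‖₊ : ℝ≥0∞)) = (k : ℝ≥0∞) := by simp
  have hsqk : ∀ X, ((‖(k : ℂ) * G X‖₊ : ℝ≥0∞)) ^ 2 = ((k : ℝ≥0∞)) ^ 2 * ((‖G X‖₊ : ℝ≥0∞)) ^ 2 := by
    intro X
    rw [nnnorm_mul, ENNReal.coe_mul, mul_pow, hknorm]
  -- the trial state `Φ = k G`
  refine ⟨⟨fun X => (k : ℂ) * G X, contDiff_const.mul hG, ?_, ?_, ?_⟩, ?_, ?_⟩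
  · intro X hX
    show (k : ℂ) * G X = 0
    rw [hG0 X (Ψ.eq_zero X hX), mul_zero]
  · intro σ X
    show (k : ℂ) * G (X ∘ σ) = (k : ℂ) * G X
    rw [hGsymm]
  · show ∫⁻ X, ((‖(k : ℂ) * G X‖₊ : ℝ≥0∞)) ^ 2 = 1
    simp_rw [hsqk]
    rw [lintegral_const_mul _ hmeas, hk]
  · -- energy bound: pointwise `|∇(kG)|² + V|kG|² = k²(|∇G|² + V|G|²) ≤ k²(|∇Ψ|² + V|Ψ|²)`
    show ∫⁻ X, (kineticDensity (fun Y => (k : ℂ) * G Y) X +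
        interaction v X * ((‖(k : ℂ) * G X‖₊ : ℝ≥0∞)) ^ 2) ≤ A⁻¹ * energy v Ψ
    rw [← hk2]
    calc ∫⁻ X, (kineticDensity (fun Y => (k : ℂ) * G Y) X +
          interaction v X * ((‖(k : ℂ) * G X‖₊ : ℝ≥0∞)) ^ 2)
        ≤ ∫⁻ X, ((k : ℝ≥0∞)) ^ 2 *
            (kineticDensity Ψ.ψ X + interaction v X * ((‖Ψ.ψ X‖₊ : ℝ≥0∞)) ^ 2) := by
          refine lintegral_mono fun X => ?_
          rw [kineticDensity_const_mul_complex, hknorm, hsqk, mul_left_comm, ← mul_add]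
          exact mul_le_mul' le_rfl (add_le_add (hkin X) (mul_le_mul' le_rfl (hsq X)))
      _ = ((k : ℝ≥0∞)) ^ 2 * energy v Ψ :=
          lintegral_const_mul' _ _ (ENNReal.pow_ne_top ENNReal.coe_ne_top)
  · intro X
    show (k : ℂ) * G X = (‖(k : ℂ) * G X‖ : ℂ)
    rw [hGreal X]
    have h0 : 0 ≤ (k : ℝ) * ‖G X‖ := mul_nonneg k.coe_nonneg (norm_nonneg _)
    rw [show ((k : ℂ)) * ((‖G X‖ : ℝ) : ℂ) = (((k : ℝ) * ‖G X‖ : ℝ) : ℂ) by push_cast; rfl,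
      Complex.norm_real, Real.norm_of_nonneg h0]

/-! ### The regularised modulus `G_ε = √(ε² + |Ψ|²) − ε` -/

/-- `G_ε = √(ε² + |Ψ|²) − ε` (complexified) is `C¹` for `ε > 0`. [folklore] -/
theorem contDiff_sqrtReg_trialState (Ψ : TrialState N L) {ε : ℝ} (hε : 0 < ε) :
    ContDiff ℝ 1 (fun X : Config N => ((Real.sqrt (ε ^ 2 + ‖Ψ.ψ X‖ ^ 2) - ε : ℝ) : ℂ)) := by
  have h := contDiff_sqrtReg (fun _ : Fin 1 => Ψ.ψ) (fun _ => Ψ.contDiff) hε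
  simp only [Fin.sum_univ_one] at h
  exact Complex.ofRealCLM.contDiff.comp h

/-- **Diamagnetic / convexity inequality**, summed over particles and axes:
`|∇G_ε|² ≤ |∇Ψ|²` pointwise for the kinetic densities. [cite: LiebLoss2001, Thm. 7.8] -/
theorem kineticDensity_sqrtReg_le (Ψ : TrialState N L) {ε : ℝ} (hε : 0 < ε) (X : Config N) :
    kineticDensity (fun Y : Config N => ((Real.sqrt (ε ^ 2 + ‖Ψ.ψ Y‖ ^ 2) - ε : ℝ) : ℂ)) X ≤
      kineticDensity Ψ.ψ X := by
  have hd : ∀ _j : Fin 1, DifferentiableAt ℝ Ψ.ψ X :=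
    fun _ => (Ψ.contDiff.differentiable one_ne_zero) X
  unfold kineticDensity
  refine Finset.sum_le_sum fun i _ => Finset.sum_le_sum fun k _ => ?_
  have h := nnnorm_fderiv_ofReal_sqrtReg_sq_le (fun _ : Fin 1 => Ψ.ψ) hd hε
    (Pi.single i (EuclideanSpace.single k (1 : ℝ)))
  simp only [Fin.sum_univ_one] at h
  exact h

/-- `|G_ε|² ≤ |Ψ|²` pointwise (in `ℝ≥0∞`). [folklore] -/
theorem nnnorm_sqrtReg_sq_le (Ψ : TrialState N L) {ε : ℝ} (hε : 0 < ε) (X : Config N) :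
    ((‖((Real.sqrt (ε ^ 2 + ‖Ψ.ψ X‖ ^ 2) - ε : ℝ) : ℂ)‖₊ : ℝ≥0∞)) ^ 2 ≤
      ((‖Ψ.ψ X‖₊ : ℝ≥0∞)) ^ 2 := by
  have h := nnnorm_ofReal_sqrtReg_sq_le (fun _ : Fin 1 => Ψ.ψ) X hε
  simp only [Fin.sum_univ_one] at h
  exact h

/-- `G_ε` is real and non-negative: `G_ε = ‖G_ε‖` as complex numbers. [folklore] -/
theorem sqrtReg_eq_norm (Ψ : TrialState N L) {ε : ℝ} (hε : 0 < ε) (X : Config N) :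
    ((Real.sqrt (ε ^ 2 + ‖Ψ.ψ X‖ ^ 2) - ε : ℝ) : ℂ) =
      (‖((Real.sqrt (ε ^ 2 + ‖Ψ.ψ X‖ ^ 2) - ε : ℝ) : ℂ)‖ : ℂ) := by
  rw [Complex.norm_real, Real.norm_of_nonneg (sqrtReg_nonneg hε.le (sq_nonneg _))]

/-- `G_ε` vanishes wherever `Ψ` does (so it inherits the Dirichlet condition). [folklore] -/
theorem sqrtReg_eq_zero_of_eq_zero (Ψ : TrialState N L) {ε : ℝ} (hε : 0 < ε) (X : Config N)
    (hX : Ψ.ψ X = 0) : ((Real.sqrt (ε ^ 2 + ‖Ψ.ψ X‖ ^ 2) - ε : ℝ) : ℂ) = 0 := by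
  rw [hX, norm_zero, zero_pow two_ne_zero, add_zero, Real.sqrt_sq hε.le, sub_self,
    Complex.ofReal_zero]

/-- `G_ε` is Bose-symmetric because `Ψ` is. [folklore] -/
theorem sqrtReg_comp_perm (Ψ : TrialState N L) (ε : ℝ) (σ : Equiv.Perm (Fin N)) (X : Config N) :
    ((Real.sqrt (ε ^ 2 + ‖Ψ.ψ (X ∘ σ)‖ ^ 2) - ε : ℝ) : ℂ) =
      ((Real.sqrt (ε ^ 2 + ‖Ψ.ψ X‖ ^ 2) - ε : ℝ) : ℂ) := by
  rw [Ψ.symm σ X]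

/-- **Removing the regularisation**: `∫ |G_{1/(n+1)}|² → ∫ |Ψ|² = 1` (dominated convergence:
`G_ε² ≤ |Ψ|²`, `∫|Ψ|² = 1 < ∞`, and `G_ε → |Ψ|` pointwise as `ε → 0⁺`). [folklore] -/
theorem tendsto_lintegral_sqrtReg_sq (Ψ : TrialState N L) :
    Tendsto (fun n : ℕ => ∫⁻ X, ((‖((Real.sqrt ((1 / ((n : ℝ) + 1)) ^ 2 + ‖Ψ.ψ X‖ ^ 2) -
        1 / ((n : ℝ) + 1) : ℝ) : ℂ)‖₊ : ℝ≥0∞)) ^ 2) atTop (𝓝 1) := by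
  have h : Tendsto (fun n : ℕ => ∫⁻ X, ((‖((Real.sqrt ((1 / ((n : ℝ) + 1)) ^ 2 + ‖Ψ.ψ X‖ ^ 2) -
        1 / ((n : ℝ) + 1) : ℝ) : ℂ)‖₊ : ℝ≥0∞)) ^ 2) atTop (𝓝 (∫⁻ X, ((‖Ψ.ψ X‖₊ : ℝ≥0∞)) ^ 2)) := by
    refine tendsto_lintegral_of_dominated_convergence (fun X => ((‖Ψ.ψ X‖₊ : ℝ≥0∞)) ^ 2)
      (fun n => ?_) (fun n => ?_) ?_ ?_
    · exact ((contDiff_sqrtReg_trialState Ψ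
        Nat.one_div_pos_of_nat).continuous.measurable.nnnorm.coe_nnreal_ennreal).pow_const 2
    · exact ae_of_all _ fun X => nnnorm_sqrtReg_sq_le Ψ Nat.one_div_pos_of_nat X
    · rw [Ψ.norm_eq]
      exact ENNReal.one_ne_top
    · refine ae_of_all _ fun X => ?_
      have hX := ENNReal.tendsto_ofReal (tendsto_sqrtReg_sq (sq_nonneg ‖Ψ.ψ X‖))
      rw [← coe_nnnorm_pow_two_eq_ofReal] at hX
      refine hX.congr fun n => ?_
      rw [Complex.nnnorm_real, coe_nnnorm_pow_two_eq_ofReal, Real.norm_eq_abs, sq_abs]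
  rwa [Ψ.norm_eq] at h

/-- **Non-negative comparison states at arbitrarily small energy cost**: for every trial state
`Ψ` of finite energy and every `η ≠ 0` there is a non-negative trial state `Φ` (`Φ = ‖Φ‖`) with
`energy v Φ ≤ energy v Ψ + η` — namely `Φ = G_ε/‖G_ε‖₂` for `ε = 1/(n+1)` small.
[cite: LiebLoss2001, Thm. 7.8] -/
theorem exists_nonneg_energy_le_add (v : ℝ → ℝ≥0∞) (Ψ : TrialState N L)
    (hE : energy v Ψ ≠ ⊤) {η : ℝ≥0∞} (hη : η ≠ 0) :
    ∃ Φ : TrialState N L, energy v Φ ≤ energy v Ψ + η ∧ ∀ X, Φ.ψ X = (‖Φ.ψ X‖ : ℂ) := by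
  set A : ℕ → ℝ≥0∞ := fun n => ∫⁻ X, ((‖((Real.sqrt ((1 / ((n : ℝ) + 1)) ^ 2 + ‖Ψ.ψ X‖ ^ 2) -
    1 / ((n : ℝ) + 1) : ℝ) : ℂ)‖₊ : ℝ≥0∞)) ^ 2 with hA
  have hlim : Tendsto A atTop (𝓝 1) := tendsto_lintegral_sqrtReg_sq Ψ
  have h1 : ∀ᶠ n in atTop, A n ≠ 0 := hlim.eventually_ne one_ne_zero
  have h2 : ∀ᶠ n in atTop, (A n)⁻¹ * energy v Ψ < energy v Ψ + η := by
    have ht : Tendsto (fun n => (A n)⁻¹ * energy v Ψ) atTop (𝓝 ((1 : ℝ≥0∞)⁻¹ * energy v Ψ)) :=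
      ENNReal.Tendsto.mul_const hlim.inv (Or.inr hE)
    rw [inv_one, one_mul] at ht
    exact ht.eventually (eventually_lt_nhds (ENNReal.lt_add_right hE hη))
  obtain ⟨n, hn0, hn⟩ := (h1.and h2).exists
  have hε : (0 : ℝ) < 1 / ((n : ℝ) + 1) := Nat.one_div_pos_of_nat
  obtain ⟨Φ, hΦ, hpos⟩ := exists_trialState_of_dominated v Ψ
    (contDiff_sqrtReg_trialState Ψ hε) (fun X hX => sqrtReg_eq_zero_of_eq_zero Ψ hε X hX)
    (fun σ X => sqrtReg_comp_perm Ψ _ σ X) (fun X => sqrtReg_eq_norm Ψ hε X)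
    (fun X => kineticDensity_sqrtReg_le Ψ hε X) (fun X => nnnorm_sqrtReg_sq_le Ψ hε X) hn0
  exact ⟨Φ, hΦ.trans hn.le, hpos⟩

end PositiveNearMinimiserExists

open PositiveNearMinimiserExists in
/-- **`PositiveNearMinimiserExists` (stmt-AtomisticToContinuum-12845).** Whenever
`E₀(N, L) = groundStateEnergy v N L ≠ ⊤`, for every `δ > 0` there is a `δ`-near-minimiser
`Φ ∈ TrialState N L` that is pointwise real and non-negative, `Φ = ‖Φ‖`: pick `Ψ` with
`energy v Ψ < E₀ + δ'/2`, `δ' = min δ 1`, and apply `exists_nonneg_energy_le_add` with slack `δ'/2`.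
[cite: LiebLoss2001, Thm. 7.8] -/
theorem positiveNearMinimiserExists_proof :
    Summit.AtomisticToContinuum.BoseEinsteinCondensation.Theses.BECRieszReverseHolder.PositiveNearMinimiserExists := by
  intro v N L hE₀ δ hδ
  set δ' : ℝ≥0∞ := min δ 1 with hδ'
  have hδ'0 : δ' ≠ 0 := (lt_min hδ one_pos).ne'
  have hhalf : δ' / 2 ≠ 0 := (ENNReal.half_pos hδ'0).ne'
  have hlt : groundStateEnergy v N L < groundStateEnergy v N L + δ' / 2 :=
    ENNReal.lt_add_right hE₀ hhalf
  obtain ⟨Ψ, hΨ⟩ := iInf_lt_iff.1 hlt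
  obtain ⟨Φ, hΦ, hpos⟩ := exists_nonneg_energy_le_add v Ψ (ne_top_of_lt hΨ) hhalf
  refine ⟨Φ, ?_, hpos⟩
  have hΨle : energy v Ψ ≤ groundStateEnergy v N L + δ' / 2 := hΨ.le
  have hδ'le : δ' ≤ δ := min_le_left _ _
  calc energy v Φ ≤ energy v Ψ + δ' / 2 := hΦ
    _ ≤ groundStateEnergy v N L + δ' / 2 + δ' / 2 := by gcongr
    _ = groundStateEnergy v N L + δ' := by rw [add_assoc, ENNReal.add_halves]
    _ ≤ groundStateEnergy v N L + δ := by gcongr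

end Summit.AtomisticToContinuum.BoseEinsteinCondensation.Theorems

end
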